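import Literature.NumberTheory.DiophantineGeometry.AbcDepthCensusFast

/-!
# A certified census of abc triples by 5-depth in boxes `c ≤ N` — the chunked checker

Fourth layer over `AbcDepthCensus.lean` / `AbcDepthCensusCRT.lean` / `AbcDepthCensusFast.lean`, with the
same soundness statement, for cells whose depth-pattern tree is too large for ONE compiled evaluation
(e.g. `ω₅ ≥ 8` in the box `2.3·10¹⁶`: `1.3·10⁷` patterns; `ω₅ ≥ 7` in `10¹⁵`: `9.4·10⁶`).  The pattern
generator `patterns N ps k A B C` is a depth-first walk of a 4-ary decision tree (for each prime of the
ascending list: skip it, or assign its fifth power to `a`, `b` or `c`); a CHUNK is the sub-tree below a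
node, named by the list of decisions (`Fin 4`: `0` = skip, `1/2/3` = to `a/b/c`) leading to it:

* `followPrefix N π ps k A B C` replays the decisions `π` from the node `(ps, k, A, B, C)` with exactly
  the pruning and size tests of `patterns`, then lists the sub-tree by `patternsAcc`
  (`followPrefix_subset`: a sub-list of `patterns` as a set; `followPrefix_append`: longer prefixes give
  smaller chunks; `exists_followPrefix`: every pattern lies in some chunk of every depth `d`);
* `coversAll S d` checks that a finite set `S` of prefixes meets every decision sequence of length `d`
  (so the chunks named by `S` cover the whole tree, `exists_mem_followPrefix_of_coversAll`);
* `checkCellChunk N R K π test` runs the hoisted-unit CRT walk `loopCRTe` on one chunk, and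
  `checkCellChunks_sound` concludes, from `coversAll S d = true` and the acceptance of every chunk of `S`
  — facts that consumers prove one `native_decide` at a time, in as many files as they like — that `test`
  holds on every abc triple with `c ≤ N` and `ω₅(abc) ≥ K` (`N < (R+1)⁵`); `depth_lt_of_checkCellChunks`,
  `depth_lt_of_checkCellChunks_gcd`, `hits_complete_of_checkCellChunks` follow.

No axiom beyond `propext`, `Classical.choice`, `Quot.sound`; compiled evaluations live with the consumers
(`Summits/ABC/ABC/Theorems/IneffectiveSubspaceDeepRegimeABCCensus*.lean`).  Source of the algorithm: this
project (standard work-splitting of a depth-first enumeration); the facts certified are finite computations.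
-/

namespace Literature.NumberTheory.DiophantineGeometry.DepthCensus

/-! ## Chunks of the pattern tree -/

/-- `followPrefix N π ps k A B C`: the patterns of the sub-tree of `patterns N ps k A B C` reached by the
decisions `π` (`0` = skip the next prime, `1/2/3` = assign its fifth power to `a/b/c`), replaying the
pruning test `N³ < 4·ABC·p^(5k)` and the size tests `X·p⁵ ≤ N` of `patterns` along the way; at a leaf
(`k = 0`) only the all-skip continuation keeps the pattern. [folklore] -/
def followPrefix (N : ℕ) : List (Fin 4) → List ℕ → ℕ → ℕ → ℕ → ℕ → List (ℕ × ℕ × ℕ)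
  | [], ps, k, A, B, C => patternsAcc (N ^ 3) N ps k A B C []
  | δ :: π, ps, 0, A, B, C => if δ = 0 then followPrefix N π ps 0 A B C else []
  | _ :: _, [], _ + 1, _, _, _ => []
  | δ :: π, p :: ps, k + 1, A, B, C =>
      if N ^ 3 < 4 * (A * B * C) * p ^ (5 * (k + 1)) then [] else
        if δ = 0 then followPrefix N π ps (k + 1) A B C
        else if δ = 1 then (if A * p ^ 5 ≤ N then followPrefix N π ps k (A * p ^ 5) B C else [])
        else if δ = 2 then (if B * p ^ 5 ≤ N then followPrefix N π ps k A (B * p ^ 5) C else [])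
        else (if C * p ^ 5 ≤ N then followPrefix N π ps k A B (C * p ^ 5) else [])

/-- A chunk lists only patterns. [folklore] -/
theorem followPrefix_subset (N : ℕ) (x : ℕ × ℕ × ℕ) :
    ∀ (π : List (Fin 4)) (ps : List ℕ) (k A B C : ℕ),
      x ∈ followPrefix N π ps k A B C → x ∈ patterns N ps k A B C := by
  intro π
  induction π with
  | nil =>
    intro ps k A B C h
    simpa [followPrefix, mem_patternsAcc] using h
  | cons δ π ih =>
    intro ps k A B C h
    cases k with
    | zero =>
      simp only [followPrefix] at h
      split_ifs at h with h0
      · exact ih _ 0 A B C h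
      · simp at h
    | succ k =>
      cases ps with
      | nil => simp [followPrefix] at h
      | cons p ps =>
        simp only [followPrefix] at h
        simp only [patterns]
        by_cases hpr : N ^ 3 < 4 * (A * B * C) * p ^ (5 * (k + 1))
        · simp [hpr] at h
        · simp only [if_neg hpr] at h
          simp only [if_neg hpr, List.mem_append]
          split_ifs at h with h1 h2 hA h3 hB hC
          · exact Or.inl (ih _ _ _ _ _ h)
          · exact Or.inr (Or.inl (by simpa [hA] using ih _ _ _ _ _ h))
          · simp at h
          · exact Or.inr (Or.inr (Or.inl (by simpa [hB] using ih _ _ _ _ _ h)))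
          · simp at h
          · exact Or.inr (Or.inr (Or.inr (by simpa [hC] using ih _ _ _ _ _ h)))
          · simp at h

/-- Longer prefixes give smaller chunks. [folklore] -/
theorem followPrefix_append (N : ℕ) (x : ℕ × ℕ × ℕ) :
    ∀ (π σ : List (Fin 4)) (ps : List ℕ) (k A B C : ℕ),
      x ∈ followPrefix N (π ++ σ) ps k A B C → x ∈ followPrefix N π ps k A B C := by
  intro π
  induction π with
  | nil =>
    intro σ ps k A B C h
    rw [List.nil_append] at h
    simpa [followPrefix, mem_patternsAcc] using followPrefix_subset N x σ ps k A B C h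
  | cons δ π ih =>
    intro σ ps k A B C h
    rw [List.cons_append] at h
    cases k with
    | zero =>
      simp only [followPrefix] at h ⊢
      split_ifs at h ⊢ with h0
      · exact ih _ _ _ _ _ _ h
      · exact h
    | succ k =>
      cases ps with
      | nil => simp [followPrefix] at h
      | cons p ps =>
        simp only [followPrefix] at h ⊢
        split_ifs at h ⊢ <;> first | exact ih _ _ _ _ _ _ h | exact h

/-- Every pattern lies in some chunk of every depth. [folklore] -/
theorem exists_followPrefix (N : ℕ) (x : ℕ × ℕ × ℕ) (d : ℕ) :
    ∀ (ps : List ℕ) (k A B C : ℕ), x ∈ patterns N ps k A B C →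
      ∃ π : List (Fin 4), π.length = d ∧ x ∈ followPrefix N π ps k A B C := by
  induction d with
  | zero =>
    intro ps k A B C h
    exact ⟨[], rfl, by simpa [followPrefix, mem_patternsAcc] using h⟩
  | succ d ih =>
    intro ps k A B C h
    cases k with
    | zero =>
      obtain ⟨π, hπ, hx⟩ := ih ps 0 A B C h
      exact ⟨0 :: π, by simp [hπ], by simpa [followPrefix] using hx⟩
    | succ k =>
      cases ps with
      | nil => simp [patterns] at h
      | cons p ps =>
        simp only [patterns] at h
        by_cases hpr : N ^ 3 < 4 * (A * B * C) * p ^ (5 * (k + 1))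
        · simp [hpr] at h
        · simp only [if_neg hpr, List.mem_append] at h
          rcases h with h | h | h | h
          · obtain ⟨π, hπ, hx⟩ := ih _ _ _ _ _ h
            exact ⟨0 :: π, by simp [hπ], by simpa [followPrefix, hpr] using hx⟩
          · by_cases hA : A * p ^ 5 ≤ N
            · rw [if_pos hA] at h
              obtain ⟨π, hπ, hx⟩ := ih _ _ _ _ _ h
              exact ⟨1 :: π, by simp [hπ], by simpa [followPrefix, hpr, hA] using hx⟩
            · simp [hA] at h
          · by_cases hB : B * p ^ 5 ≤ N
            · rw [if_pos hB] at h
              obtain ⟨π, hπ, hx⟩ := ih _ _ _ _ _ h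
              exact ⟨2 :: π, by simp [hπ], by simpa [followPrefix, hpr, hB] using hx⟩
            · simp [hB] at h
          · by_cases hC : C * p ^ 5 ≤ N
            · rw [if_pos hC] at h
              obtain ⟨π, hπ, hx⟩ := ih _ _ _ _ _ h
              exact ⟨3 :: π, by simp [hπ], by simpa [followPrefix, hpr, hC] using hx⟩
            · simp [hC] at h

/-! ## Covers of the decision tree -/

/-- All decision sequences of length `d`. [folklore] -/
def allSeqs : ℕ → List (List (Fin 4))
  | 0 => [[]]
  | d + 1 => (allSeqs d).flatMap (fun π => (List.finRange 4).map (fun δ => δ :: π))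

/-- `allSeqs d` lists exactly the sequences of length `d`. [folklore] -/
theorem mem_allSeqs {d : ℕ} {π : List (Fin 4)} : π ∈ allSeqs d ↔ π.length = d := by
  induction d generalizing π with
  | zero => cases π <;> simp [allSeqs]
  | succ d ih =>
    cases π with
    | nil => simp [allSeqs]
    | cons δ π =>
      simp only [allSeqs, List.mem_flatMap, List.mem_map, List.mem_finRange, true_and,
        List.cons.injEq, List.length_cons, Nat.add_right_cancel_iff]
      constructor
      · rintro ⟨π', hπ', δ', rfl, rfl⟩
        exact ih.mp hπ'
      · intro h
        exact ⟨π, ih.mpr h, δ, rfl, rfl⟩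

/-- `isPrefixB s π`: `s` is a prefix of `π` (Boolean). [folklore] -/
def isPrefixB : List (Fin 4) → List (Fin 4) → Bool
  | [], _ => true
  | _ :: _, [] => false
  | a :: s, b :: π => decide (a = b) && isPrefixB s π

/-- Specification of `isPrefixB`. [folklore] -/
theorem eq_append_of_isPrefixB : ∀ {s π : List (Fin 4)}, isPrefixB s π = true → ∃ σ, π = s ++ σ
  | [], π, _ => ⟨π, rfl⟩
  | _ :: _, [], h => by simp [isPrefixB] at h
  | a :: s, b :: π, h => by
    simp only [isPrefixB, Bool.and_eq_true, decide_eq_true_eq] at h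
    obtain ⟨σ, hσ⟩ := eq_append_of_isPrefixB h.2
    exact ⟨σ, by rw [h.1, hσ, List.cons_append]⟩

/-- **Cover test**: every decision sequence of length `d` extends some member of `S`. [folklore] -/
def coversAll (S : List (List (Fin 4))) (d : ℕ) : Bool :=
  (allSeqs d).all (fun π => S.any (fun s => isPrefixB s π))

/-- If `S` covers depth `d`, every pattern lies in the chunk of some member of `S`. [folklore] -/
theorem exists_mem_followPrefix_of_coversAll {N : ℕ} {S : List (List (Fin 4))} {d : ℕ}
    (hS : coversAll S d = true) {x : ℕ × ℕ × ℕ} {ps : List ℕ} {k A B C : ℕ}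
    (hx : x ∈ patterns N ps k A B C) : ∃ s ∈ S, x ∈ followPrefix N s ps k A B C := by
  obtain ⟨π, hπ, hxπ⟩ := exists_followPrefix N x d ps k A B C hx
  rw [coversAll, List.all_eq_true] at hS
  have hπS := hS π (mem_allSeqs.mpr hπ)
  rw [List.any_eq_true] at hπS
  obtain ⟨s, hs, hsp⟩ := hπS
  obtain ⟨σ, rfl⟩ := eq_append_of_isPrefixB hsp
  exact ⟨s, hs, followPrefix_append N x s σ ps k A B C hxπ⟩

/-! ## The chunked cell checker -/

/-- **One chunk of the cell check**: the hoisted-unit CRT walk on every pattern of the chunk `π`.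
[folklore] -/
def checkCellChunk (N R K : ℕ) (π : List (Fin 4)) (test : ℕ → ℕ → ℕ → Bool) : Bool :=
  (followPrefix N π (deepPrimes N R) K 1 1 1).all (fun t => loopCRTe N t.1 t.2.1 t.2.2 test)

/-- **Soundness of the chunked check.** If `N < (R+1)⁵`, `S` covers some depth `d`, and every chunk named
in `S` is accepted, then `test` holds on every abc triple with `c ≤ N` and `ω₅(abc) ≥ K`. [folklore] -/
theorem checkCellChunks_sound {N R K : ℕ} {test : ℕ → ℕ → ℕ → Bool} (hR : N < (R + 1) ^ 5)
    {S : List (List (Fin 4))} {d : ℕ} (hS : coversAll S d = true)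
    (h : ∀ s ∈ S, checkCellChunk N R K s test = true) {a b c : ℕ} (habc : IsABCTriple a b c)
    (hcN : c ≤ N)
    (hK : K ≤ ((a * b * c).primeFactors.filter (fun p => 5 ≤ (a * b * c).factorization p)).card) :
    test a b c = true := by
  refine sound_of_forall_patterns (loop := loopCRTe)
    (fun hA hB hC hl _ _ _ ha hb hc ha0 hb0 hs hN => loopCRTe_sound hA hB hC hl ha hb hc ha0 hb0 hs hN)
    hR (fun t ht => ?_) habc hcN hK
  obtain ⟨s, hs, hts⟩ := exists_mem_followPrefix_of_coversAll hS ht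
  have hrun := h s hs
  rw [checkCellChunk, List.all_eq_true] at hrun
  exact hrun t hts

/-- **Empty cells (chunked).** [folklore] -/
theorem depth_lt_of_checkCellChunks {N R K : ℕ} (hR : N < (R + 1) ^ 5) {S : List (List (Fin 4))}
    {d : ℕ} (hS : coversAll S d = true)
    (h : ∀ s ∈ S, checkCellChunk N R K s (fun _ _ _ => false) = true) {a b c : ℕ}
    (habc : IsABCTriple a b c) (hcN : c ≤ N) :
    ((a * b * c).primeFactors.filter (fun p => 5 ≤ (a * b * c).factorization p)).card < K := by
  by_contra hK
  exact Bool.false_ne_true (checkCellChunks_sound hR hS h habc hcN (not_lt.mp hK))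

/-- **No abc triple in the cell-in-the-box (chunked)**, from the test "`gcd(a,b) ≠ 1`". [folklore] -/
theorem depth_lt_of_checkCellChunks_gcd {N R K : ℕ} (hR : N < (R + 1) ^ 5) {S : List (List (Fin 4))}
    {d : ℕ} (hS : coversAll S d = true)
    (h : ∀ s ∈ S, checkCellChunk N R K s (fun a b _ => !(Nat.gcd a b == 1)) = true) {a b c : ℕ}
    (habc : IsABCTriple a b c) (hcN : c ≤ N) :
    ((a * b * c).primeFactors.filter (fun p => 5 ≤ (a * b * c).factorization p)).card < K := by
  by_contra hK
  have hrun := checkCellChunks_sound hR hS h habc hcN (not_lt.mp hK)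
  have hcop : Nat.gcd a b = 1 := habc.2.2.2
  simp [hcop] at hrun

/-- **Census (chunked).** If every chunk of a cover accepts `hitTest L`, every abc hit of the cell
`{ω₅ ≥ K}` in the box `{c ≤ N}` is listed in `L` with its radical, in one of the two orientations.
[folklore] -/
theorem hits_complete_of_checkCellChunks {N R K : ℕ} {L : List (ℕ × ℕ × ℕ × ℕ)}
    (hR : N < (R + 1) ^ 5) {S : List (List (Fin 4))} {d : ℕ} (hS : coversAll S d = true)
    (h : ∀ s ∈ S, checkCellChunk N R K s (hitTest L) = true) {a b c : ℕ}
    (habc : IsABCTriple a b c) (hcN : c ≤ N)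
    (hK : K ≤ ((a * b * c).primeFactors.filter (fun p => 5 ≤ (a * b * c).factorization p)).card)
    (hlt : rad a b c < c) : (a, b, c, rad a b c) ∈ L ∨ (b, a, c, rad a b c) ∈ L :=
  hitTest_sound habc (checkCellChunks_sound hR hS h habc hcN hK) hlt

end Literature.NumberTheory.DiophantineGeometry.DepthCensus
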